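import Literature.MathematicalPhysics.QuantumFieldTheory.Balaban1983to89.B9WalkLettersKernels
import Literature.MathematicalPhysics.QuantumFieldTheory.Balaban1983to89.B9Thm37CommutatorBound389
import Literature.MathematicalPhysics.QuantumFieldTheory.Balaban1983to89.B9Thm37CubeCoverCommutatorSizes
import Literature.MathematicalPhysics.QuantumFieldTheory.Balaban1983to89.Node00.OpsYLeibnizLetters

/-!
# `Balaban1983to89.B9WalkLettersKernelsStatic` — W-a FILE C-2 (part 2b, proofs I): THE STENCIL FACTS OF THE PARTITION OF UNITY `h_□` READ THROUGH THE
# CERTIFICATE'S SITE PIN — supports, distances and sizes feeding the kernels of record (`B9WalkLettersKernels`) of the rows-18 walk letters (3.87)–(3.90)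

statement-level skeleton of published theorems with citation tags; proofs where landed; nothing here is a claim about the Yang–Mills mass gap

B9 = T. Bałaban, *Propagators for lattice gauge theories in a background field*, Commun. Math. Phys. **99** (1985) 389–434 [Balaban1985BackgroundPropagators];
[4] = T. Bałaban, *Propagators and renormalization transformations for lattice gauge theories. II*, Commun. Math. Phys. **96** (1984) 223–250 [Balaban1984PropagatorsII].
THE PRINT.  (3.88)–(3.89) p.409: `K(h_□)G′_□h_□ = Σ_{b∈st(x)} (∂h_□)(b)(D_UG′_□h_□)(b) + (Δh_□)(x)(G′_□h_□)(x) + (averaging line)`, «a semi-local operator of size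
O(M⁻¹)»; [4] p.247 «|∂h_□| ≦ O(1)(MLʲη)⁻¹», (2.14) p.225 (the weights `a_j(Lʲη)⁻²` of the averaging operators), (2.36) p.229 + p.235 (the cubes `□̃`),
(2.45)–(2.46) p.231 (blocks and the distance `d(y,y′)`).
WHY THIS FILE (pub-ymgap, dag-n06-d W-a C-2 programme, HOME `W-a-C2-PLAN.md` §5).  Part 2a (`B9WalkLettersCoordsDom`, p662348) dominated the eight coordinate
models of the rows-18 walk letters by ANY block kernel bounding `CB ×` the input-block sums of their stencil sizes; `B9WalkLettersKernels` named the kernels of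
record (coefficient × `𝟙[a ∈ S_□]·𝟙[d ≤ 3]`).  Discharging the `hK` hypotheses at those kernels needs, on the certificate's site pin `σ = sIK bI` (1-faithful `hβ1`,
level-faithful `hlev` — the pins the certificate displays), exactly the facts of this file:
* SUPPORTS: `sIK_mem_SblkY_of_near` (one lattice step from `supp h_□` the site is pinned into `S_□` — r03∕gen-26 `B6CubeCoeffSizesV1.blkOf_mem_QT_of_near_hT`:
  the thickening stays in `QT ⊂ QbigT`), hence `sIK_mem_SblkY_of_fdiffY_ne_zero ∕ _of_bdiffY_ne_zero ∕ _of_lapDiffY_ne_zero`, `blkOf_eq_of_avgCoeffY_ne_zero`,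
  `sIK_mem_SblkY_of_avg` (block-mates of the averaging line);
* DISTANCES: `touch_self ∕ touch_shiftY ∕ touch_shiftY_symm`, ★ `dist_sIK_stencil` (`d(σ z, σ(z ± e_μ)) ≤ 3`: n06-l `dist_sIK_le_distB_add_two` + gen-26
  `dist_blkOf_le_one_of_touch`), `dist_sIK_le_two_of_blkOf_eq`;
* SIZES: `abs_fdiffY_bdiffY_le` (`≤ stepY`, M5.7 `abs_hTY_shiftY_sub_le`), `abs_lapDiffY_le` (`≤ (d+1)·lapStepY`, r03 `abs_hT_second_diff_le`),
  ★ `sum_abs_avgCoeffY_le_inv_sq` (`Σ_w |avgCoeffY z w| ≤ L^{−2 lev z}` — M5.7's `sum_abs_avgCoeffY_le_one` with the scale kept), `abs_sub_le_avgLipY`,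
  `inv_sq_pow_levY_eq` (`L^{−2 lev z} = (η∕ℓ(σ z))²` under `hlev`), `len_window_of_mem_SblkY` (r03 `window_and_congr_of_mem_QbigT`: the blocks of `□̃` have level
  `≤ j + 1`), ★ `sizes_mul_len_le` (`stepY·ℓ(a) ≤ (5∕8)C1F·η∕M_h`, `lapStepY·ℓ(a)² ≤ (5∕8)²C2F·η²∕M_h²` on `S_□` — print's `(MLʲη)⁻¹·Lʲη = M⁻¹`) and the
  arithmetic `step_arith ∕ lap_arith` the row sums consume.
The dominations at the kernels are `B9WalkLettersKernelsDom`; the row ∕ column sums `B9WalkLettersKernelsRows`; the record `opsWalkY` is part 3.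
HONEST SCOPE.  Finite sums over landed engines; no (3.42), no regime, nothing of [B9]'s analysis asserted; count-neutral; N06 NOT discharged; nothing continuum ∕
OS ∕ mass gap ∕ Clay.  Cell `pub-ymgap` (D-0062), node N06 [B9], rows 18, seat `pub-ymgap-dag-n06-d` (gen 14).  Net new unproved facts: 0.  NEW file.
-/

noncomputable section

namespace Literature.MathematicalPhysics.QuantumFieldTheory.Balaban1983to89.B9WalkLettersKernelsStatic

open Node00
open Node00.OpsYLeibnizLetters (fdiffY bdiffY lapDiffY fdiffY_apply bdiffY_apply lapDiffY_apply)
open B6KLevelCensusIndexV1 (KIdx)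
open B6Ineq2142KLevelV1 (β lvl)
open B4Reflection242 (boxDom blk)
open B4TorusKernel.MultiPeriod (torusSupNorm torusSupNorm_le_supNorm)
open B6MultiLevelBoxOperator (bigSide bigSide_eq one_le_bigSide levC aPrinted)
open B6MultiLevelTorusOperator (tshift unitVec tshift_symm_apply one_le_of_mem)
open B6Geom246MultiLevelBox (blkOf blkOf_eq_of_blk_i_eq)
open B6Geom246MultiLevelTorus (bondT)
open B6Cover236MultiLevelBlocks (cubes)
open B6Partition118KLevelTorus (hT)
open B6Partition118KLevelFineSizes (C1F C1F_nonneg)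
open B6Partition118KLevelFineSecond (C2F C2F_nonneg)
open B6Partition118KLevelTorusCentral (QT QT_subset_QbigT)
open B6Partition118KLevelTorusBinders (sLipT sLipT_nonneg abs_hT_second_diff_le)
open B6Cover236QbigOverlapV1 (window_and_congr_of_mem_QbigT)
open B6CubeCoeffSizesV1 (blkOf_mem_QT_of_near_hT)
open B9Thm37CubeCoverCommutators (hTY one_le_Mh_and_P)
open B9Thm37CubeCoverCommutatorSizes (side_conditions abs_hTY_shiftY_sub_le abs_hTY_shiftY_symm_sub_le abs_hTY_sub_le_of_avgCoeffY_ne_zero avgCoeffY_nonneg four_le_P')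
open B9Thm37CommutatorBound389 (torusSupNorm_sub_shiftY_le_one dist_blkOf_le_one_of_touch blkOf_fst_fst)
open B9Ineq349SiteComposite (lenB distB lenB_eq etaS_pos)
open B9Ineq349SiteFromBlocks (geo9Y_dist_eq_distB geo9Y_M_eq)
open B9PinMembersKLevelV1 (MemberY geo9Y)
open B9GeoLemma21KLevelV1 (geo9K_dist_comm geo9Y_dist_comm geo9Y_dist_self geo9Y_len_pos)
open B9CoReadingCoordsS (XSK blkSK sIK sIK_level)
open B9CoordSliceMajorant (len_sIK_eq_lenB)
open B9SitePinBlockCounts (dist_sIK_le_distB_add_two)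
open B9WalkLettersCoordsS (cubeBlksY cubeDomY SblkY two_le_Mh four_le_P)
open B9WalkLettersKernels

variable {d ℓ : ℕ} {hd : 1 ≤ d + 1} {hL : Odd (ℓ + 1) ∧ 1 < ℓ + 1} {b₀ b₁ : ℝ} {Mstar : ℕ}

/-! ## §1 The stencil facts of `h_□` read through the site pin `σ = sIK bI` -/

section Stencil

variable (x : MemberY d ℓ hd hL b₀ b₁ Mstar) (bI : FBondY x.toKIdx → IBondY x.toKIdx)

/-- a site touches itself: `|z − z|_T ≤ 1`. [cite: Balaban1984PropagatorsII, (2.46) p.231, bookkeeping] -/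
theorem touch_self (z : SiteY x.toKIdx) : torusSupNorm (toKT x.toKIdx).NB (z.1 - z.1) ≤ 1 := by
  rw [sub_self]
  refine (torusSupNorm_le_supNorm (one_le_of_mem z.2) _).trans (B4Reflection242.supNorm_le_of_forall fun ν => ?_)
  simp

/-- the forward neighbour touches: `|(z + e_μ) − z|_T ≤ 1`. [cite: Balaban1984PropagatorsII, (2.46) p.231, bookkeeping] -/
theorem touch_shiftY (μ : Fin (d + 1)) (z : SiteY x.toKIdx) : torusSupNorm (toKT x.toKIdx).NB ((shiftY x.toKIdx μ z).1 - z.1) ≤ 1 := by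
  have h := (torusSupNorm_sub_shiftY_le_one x.toKIdx μ (shiftY x.toKIdx μ z)).2
  rwa [Equiv.symm_apply_apply] at h

/-- the backward neighbour touches: `|(z − e_μ) − z|_T ≤ 1`. [cite: Balaban1984PropagatorsII, (2.46) p.231, bookkeeping] -/
theorem touch_shiftY_symm (μ : Fin (d + 1)) (z : SiteY x.toKIdx) : torusSupNorm (toKT x.toKIdx).NB (((shiftY x.toKIdx μ).symm z).1 - z.1) ≤ 1 := by
  have h := (torusSupNorm_sub_shiftY_le_one x.toKIdx μ ((shiftY x.toKIdx μ).symm z)).1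
  rwa [Equiv.apply_symm_apply] at h

/-- ★ **ONE STEP FROM `supp h_□` THE SITE IS PINNED INTO `S_□`**: if `h_□(z′) ≠ 0` and `|z − z′|_T ≤ 1` then `σ z ∈ S_□(c)` (r03∕gen-26: the one-step thickening of
`supp h_□` stays in the blocks `□⁺ ⊂ □̃`). [cite: Balaban1985BackgroundPropagators, (3.89) p.409 («x ∈ Δ(y), y, y′ ∈ □»); Balaban1984PropagatorsII, p.235, (2.134) p.247] -/
theorem sIK_mem_SblkY_of_near (c : ↥(cubes x.toKIdx.D.toDomains)) {z z' : SiteY x.toKIdx} (h : hTY x.toKIdx c z' ≠ 0)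
    (hzz' : torusSupNorm (toKT x.toKIdx).NB (z.1 - z'.1) ≤ 1) : sIK x.toKIdx bI z ∈ SblkY x bI c := by
  obtain ⟨hℓ, _, hR, hP5⟩ := side_conditions x.toKIdx
  have hq := blkOf_mem_QT_of_near_hT x.toKIdx.D hℓ x.toKIdx.hM8 hR hP5 (hMh1 := (one_le_Mh_and_P x.toKIdx).1) (four_le_P x) c h hzz'
  unfold SblkY cubeDomY cubeBlksY
  exact Finset.mem_image_of_mem _ (Finset.mem_filter.2 ⟨Finset.mem_univ _, QT_subset_QbigT _ _ c hq⟩)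

/-- `∂⁺_μh_□(z) ≠ 0 ⟹ σ z, σ(z + e_μ) ∈ S_□`. [cite: Balaban1985BackgroundPropagators, (3.88)–(3.89) p.409] -/
theorem sIK_mem_SblkY_of_fdiffY_ne_zero (c : ↥(cubes x.toKIdx.D.toDomains)) (μ : Fin (d + 1)) {z : SiteY x.toKIdx}
    (h : fdiffY x.toKIdx (hTY x.toKIdx c) μ z ≠ 0) : sIK x.toKIdx bI z ∈ SblkY x bI c ∧ sIK x.toKIdx bI (shiftY x.toKIdx μ z) ∈ SblkY x bI c := by
  rw [fdiffY_apply] at h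
  by_cases hz : hTY x.toKIdx c z ≠ 0
  · exact ⟨sIK_mem_SblkY_of_near x bI c hz (touch_self x z), sIK_mem_SblkY_of_near x bI c hz (touch_shiftY x μ z)⟩
  · push Not at hz
    have h' : hTY x.toKIdx c (shiftY x.toKIdx μ z) ≠ 0 := by intro h0; exact h (by rw [h0, hz, sub_zero])
    exact ⟨sIK_mem_SblkY_of_near x bI c h' (torusSupNorm_sub_shiftY_le_one x.toKIdx μ z).1, sIK_mem_SblkY_of_near x bI c h' (touch_self x _)⟩

/-- `∂⁻̃_μh_□(z) ≠ 0 ⟹ σ z, σ(z − e_μ) ∈ S_□`. [cite: Balaban1985BackgroundPropagators, (3.88)–(3.89) p.409] -/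
theorem sIK_mem_SblkY_of_bdiffY_ne_zero (c : ↥(cubes x.toKIdx.D.toDomains)) (μ : Fin (d + 1)) {z : SiteY x.toKIdx}
    (h : bdiffY x.toKIdx (hTY x.toKIdx c) μ z ≠ 0) :
    sIK x.toKIdx bI z ∈ SblkY x bI c ∧ sIK x.toKIdx bI ((shiftY x.toKIdx μ).symm z) ∈ SblkY x bI c := by
  rw [bdiffY_apply] at h
  by_cases hz : hTY x.toKIdx c z ≠ 0
  · exact ⟨sIK_mem_SblkY_of_near x bI c hz (touch_self x z), sIK_mem_SblkY_of_near x bI c hz (touch_shiftY_symm x μ z)⟩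
  · push Not at hz
    have h' : hTY x.toKIdx c ((shiftY x.toKIdx μ).symm z) ≠ 0 := by intro h0; exact h (by rw [h0, hz, sub_zero])
    exact ⟨sIK_mem_SblkY_of_near x bI c h' (torusSupNorm_sub_shiftY_le_one x.toKIdx μ z).2, sIK_mem_SblkY_of_near x bI c h' (touch_self x _)⟩

/-- `Δh_□(z) ≠ 0 ⟹ σ z ∈ S_□`. [cite: Balaban1985BackgroundPropagators, (3.88)–(3.89) p.409] -/
theorem sIK_mem_SblkY_of_lapDiffY_ne_zero (c : ↥(cubes x.toKIdx.D.toDomains)) {z : SiteY x.toKIdx} (h : lapDiffY x.toKIdx (hTY x.toKIdx c) z ≠ 0) :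
    sIK x.toKIdx bI z ∈ SblkY x bI c := by
  rw [lapDiffY_apply] at h
  obtain ⟨μ, -, hμ⟩ := Finset.exists_ne_zero_of_sum_ne_zero h
  by_cases hz : hTY x.toKIdx c z ≠ 0
  · exact sIK_mem_SblkY_of_near x bI c hz (touch_self x z)
  · push Not at hz
    rw [hz, mul_zero, sub_zero] at hμ
    by_cases h1 : hTY x.toKIdx c (shiftY x.toKIdx μ z) ≠ 0
    · exact sIK_mem_SblkY_of_near x bI c h1 (torusSupNorm_sub_shiftY_le_one x.toKIdx μ z).1
    · push Not at h1
      rw [h1, zero_add] at hμ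
      exact sIK_mem_SblkY_of_near x bI c hμ (torusSupNorm_sub_shiftY_le_one x.toKIdx μ z).2

/-- block-mates: `avgCoeffY(z, w) ≠ 0 ⟹ Δ(w) = Δ(z)`. [cite: Balaban1984PropagatorsII, (2.14) p.225, bookkeeping] -/
theorem blkOf_eq_of_avgCoeffY_ne_zero {z w : SiteY x.toKIdx} (hw : avgCoeffY x.toKIdx z w ≠ 0) : blkOf x.D.toDomains w = blkOf x.D.toDomains z := by
  have hblk : blk ((ℓ + 1) ^ levY x.toKIdx z) w.1 = blk ((ℓ + 1) ^ levY x.toKIdx z) z.1 := by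
    by_contra hne
    exact hw (by rw [avgCoeffY, B4Reflection242.avgK, if_neg hne])
  exact blkOf_eq_of_blk_i_eq (D := x.toKIdx.D.toDomains) (x := z) (x' := w) (i := levY x.toKIdx z) le_rfl hblk

/-- the averaging line: `avgCoeffY(z,w) ≠ 0` and `h_□(z) ≠ h_□(w)` ⟹ `σ z, σ w ∈ S_□`. [cite: Balaban1985BackgroundPropagators, (3.88)–(3.89) p.409] -/
theorem sIK_mem_SblkY_of_avg (c : ↥(cubes x.toKIdx.D.toDomains)) {z w : SiteY x.toKIdx} (hw : avgCoeffY x.toKIdx z w ≠ 0)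
    (h : hTY x.toKIdx c z - hTY x.toKIdx c w ≠ 0) : sIK x.toKIdx bI z ∈ SblkY x bI c ∧ sIK x.toKIdx bI w ∈ SblkY x bI c := by
  have hb := blkOf_eq_of_avgCoeffY_ne_zero x hw
  -- membership of `σ u` in `S_□` depends on `u` only through its block
  have key : ∀ {u u' : SiteY x.toKIdx}, blkOf x.D.toDomains u = blkOf x.D.toDomains u' → hTY x.toKIdx c u' ≠ 0 → sIK x.toKIdx bI u ∈ SblkY x bI c := by
    intro u u' huu' hu'
    obtain ⟨hℓ, _, hR, hP5⟩ := side_conditions x.toKIdx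
    have hq := blkOf_mem_QT_of_near_hT x.toKIdx.D hℓ x.toKIdx.hM8 hR hP5 (hMh1 := (one_le_Mh_and_P x.toKIdx).1) (four_le_P x) c hu' (touch_self x u')
    rw [← huu'] at hq
    unfold SblkY cubeDomY cubeBlksY
    exact Finset.mem_image_of_mem _ (Finset.mem_filter.2 ⟨Finset.mem_univ _, QT_subset_QbigT _ _ c hq⟩)
  by_cases hz : hTY x.toKIdx c z ≠ 0
  · exact ⟨key rfl hz, key hb hz⟩
  · push Not at hz
    have hw' : hTY x.toKIdx c w ≠ 0 := by intro h0; exact h (by rw [hz, h0, sub_zero])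
    exact ⟨key hb.symm hw', key rfl hw'⟩

/-- ★ distances through a 1-faithful pin: `d(σ z, σ z) = 0`, `d(σ z, σ(z ± e_μ)) ≤ 3`, `d(σ z, σ w) ≤ 2` for block-mates.
[cite: Balaban1984PropagatorsII, (2.45)–(2.46) p.231, (2.54) p.233] -/
theorem dist_sIK_stencil (hβ1 : ∀ f : FBondY x.toKIdx, (B6Geom246MultiLevelTorus.geomT x.D).dist (β x.hN x.D x.hk (bI f)) (B6GlobalChartV1.blkV1 x.hN x.D f) ≤ 1)
    (μ : Fin (d + 1)) (z : SiteY x.toKIdx) :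
    (geo9Y x).dist (sIK x.toKIdx bI z) (sIK x.toKIdx bI z) ≤ 3 ∧
    (geo9Y x).dist (sIK x.toKIdx bI z) (sIK x.toKIdx bI (shiftY x.toKIdx μ z)) ≤ 3 ∧
    (geo9Y x).dist (sIK x.toKIdx bI z) (sIK x.toKIdx bI ((shiftY x.toKIdx μ).symm z)) ≤ 3 := by
  refine ⟨by rw [geo9Y_dist_self]; norm_num, ?_, ?_⟩
  · have h1 := dist_sIK_le_distB_add_two x hβ1 z (shiftY x.toKIdx μ z)
    have h2 : distB x.toKIdx (blkOf x.D.toDomains z) (blkOf x.D.toDomains (shiftY x.toKIdx μ z)) ≤ 1 := by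
      show (((bondT (toKT x.toKIdx).D).dist _ _ : ℕ) : ℝ) ≤ 1
      exact_mod_cast dist_blkOf_le_one_of_touch x.toKIdx (torusSupNorm_sub_shiftY_le_one x.toKIdx μ z).1
    linarith
  · have h1 := dist_sIK_le_distB_add_two x hβ1 z ((shiftY x.toKIdx μ).symm z)
    have h2 : distB x.toKIdx (blkOf x.D.toDomains z) (blkOf x.D.toDomains ((shiftY x.toKIdx μ).symm z)) ≤ 1 := by
      show (((bondT (toKT x.toKIdx).D).dist _ _ : ℕ) : ℝ) ≤ 1
      exact_mod_cast dist_blkOf_le_one_of_touch x.toKIdx (torusSupNorm_sub_shiftY_le_one x.toKIdx μ z).2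
    linarith

/-- block-mates are pinned within distance `2`. [cite: Balaban1984PropagatorsII, (2.45)–(2.46) p.231, (2.54) p.233] -/
theorem dist_sIK_le_two_of_blkOf_eq
    (hβ1 : ∀ f : FBondY x.toKIdx, (B6Geom246MultiLevelTorus.geomT x.D).dist (β x.hN x.D x.hk (bI f)) (B6GlobalChartV1.blkV1 x.hN x.D f) ≤ 1)
    {z w : SiteY x.toKIdx} (h : blkOf x.D.toDomains w = blkOf x.D.toDomains z) : (geo9Y x).dist (sIK x.toKIdx bI z) (sIK x.toKIdx bI w) ≤ 2 := by
  have h1 := dist_sIK_le_distB_add_two x hβ1 z w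
  have h2 : distB x.toKIdx (blkOf x.D.toDomains z) (blkOf x.D.toDomains w) = 0 := by
    rw [h]
    show (((bondT (toKT x.toKIdx).D).dist _ _ : ℕ) : ℝ) = 0
    rw [SimpleGraph.dist_self, Nat.cast_zero]
  linarith

/-! ### the sizes -/

/-- `|∂⁺_μh_□| ≤ stepY`, `|∂⁻̃_μh_□| ≤ stepY`. [cite: Balaban1984PropagatorsII, p.247 («|∂h_□| ≦ O(1)(MLʲη)⁻¹»); Balaban1985BackgroundPropagators, (3.89) p.409] -/
theorem abs_fdiffY_bdiffY_le (c : ↥(cubes x.toKIdx.D.toDomains)) (μ : Fin (d + 1)) (z : SiteY x.toKIdx) :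
    |fdiffY x.toKIdx (hTY x.toKIdx c) μ z| ≤ stepY x c ∧ |bdiffY x.toKIdx (hTY x.toKIdx c) μ z| ≤ stepY x c :=
  ⟨abs_hTY_shiftY_sub_le x.toKIdx c μ z, abs_hTY_shiftY_symm_sub_le x.toKIdx c μ z⟩

/-- `|Δh_□(z)| ≤ (d+1)·lapStepY` (r03's second differences of the partition, summed over the directions).
[cite: Balaban1984PropagatorsII, p.247 («|Δh_□| ≦ O(1)(MLʲη)⁻²»); Balaban1985BackgroundPropagators, (3.89) p.409] -/
theorem abs_lapDiffY_le (c : ↥(cubes x.toKIdx.D.toDomains)) (z : SiteY x.toKIdx) :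
    |lapDiffY x.toKIdx (hTY x.toKIdx c) z| ≤ ((d : ℝ) + 1) * lapStepY x c := by
  obtain ⟨hℓ, hMh, hR, hP5⟩ := side_conditions x.toKIdx
  rw [lapDiffY_apply]
  refine (Finset.abs_sum_le_sum_abs _ _).trans ?_
  have hterm : ∀ μ : Fin (d + 1), |hTY x.toKIdx c (shiftY x.toKIdx μ z) + hTY x.toKIdx c ((shiftY x.toKIdx μ).symm z) - 2 * hTY x.toKIdx c z|
      ≤ lapStepY x c := fun μ => by
    have h := abs_hT_second_diff_le (D := x.toKIdx.D) hℓ hMh hR hP5 c μ z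
    have e1 : shiftY x.toKIdx μ z = tshift (toKT x.toKIdx).NB (unitVec μ) z := rfl
    have e2 : (shiftY x.toKIdx μ).symm z = tshift (toKT x.toKIdx).NB (-unitVec μ) z := tshift_symm_apply _ _ _
    rw [e1, e2]
    rw [show hTY x.toKIdx c (tshift (toKT x.toKIdx).NB (unitVec μ) z) + hTY x.toKIdx c (tshift (toKT x.toKIdx).NB (-unitVec μ) z) -
        2 * hTY x.toKIdx c z = hT x.toKIdx.D c (tshift (toKT x.toKIdx).NB (unitVec μ) z) - 2 * hT x.toKIdx.D c z +
        hT x.toKIdx.D c (tshift (toKT x.toKIdx).NB (-unitVec μ) z) from by unfold hTY; ring]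
    exact h
  calc ∑ μ : Fin (d + 1), |hTY x.toKIdx c (shiftY x.toKIdx μ z) + hTY x.toKIdx c ((shiftY x.toKIdx μ).symm z) - 2 * hTY x.toKIdx c z|
      ≤ ∑ _μ : Fin (d + 1), lapStepY x c := Finset.sum_le_sum fun μ _ => hterm μ
    _ = ((d : ℝ) + 1) * lapStepY x c := by rw [Finset.sum_const, Finset.card_univ, Fintype.card_fin, nsmul_eq_mul]; push_cast; ring

/-- ★ **THE TOTAL AVERAGING WEIGHT AT A SITE IS `a_j·L^{−2j} ≤ L^{−2j}`** (`j = lev z`; the `Lʲ`-block of `z` has `L^{j(d+1)}` sites and the coefficient is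
`levC = a_j L^{−2j} L^{−j(d+1)}`, `a_j ≤ 1`) — M5.7's `sum_abs_avgCoeffY_le_one` with the scale kept. [cite: Balaban1984PropagatorsII, (2.13)–(2.14) p.225 («a_j(Lʲη)^{−2} Σ L^{−jd}»)] -/
theorem sum_abs_avgCoeffY_le_inv_sq (z : SiteY x.toKIdx) :
    ∑ w, |avgCoeffY x.toKIdx z w| ≤ ((((ℓ : ℝ) + 1) ^ levY x.toKIdx z) ^ 2)⁻¹ := by
  classical
  obtain ⟨hℓ, hMh, _, _⟩ := side_conditions x.toKIdx
  set n : ℕ := (ℓ + 1) ^ levY x.toKIdx z with hn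
  have hn1 : 1 ≤ n := Nat.one_le_pow _ _ (Nat.succ_pos ℓ)
  have hterm : ∀ w : SiteY x.toKIdx, |avgCoeffY x.toKIdx z w|
      = if blk n w.1 = blk n z.1 then levC d ℓ (aPrinted ℓ 1) (levY x.toKIdx z) else 0 := fun w => by
    rw [abs_of_nonneg (avgCoeffY_nonneg x.toKIdx z w)]
    rfl
  simp_rw [hterm]
  rw [Finset.sum_ite, Finset.sum_const_zero, add_zero, Finset.sum_const, nsmul_eq_mul]
  have hcard : ((Finset.univ.filter fun w : SiteY x.toKIdx => blk n w.1 = blk n z.1).card : ℝ) ≤ ((n : ℝ)) ^ (d + 1) := by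
    have h1 : (Finset.univ.filter fun w : SiteY x.toKIdx => blk n w.1 = blk n z.1).card ≤ (B4Reflection242.blockOf n z.1).card := by
      refine Finset.card_le_card_of_injOn (fun w : SiteY x.toKIdx => (w.1 : Fin (d + 1) → ℤ)) (fun w hw => ?_) ?_
      · rw [Finset.mem_coe, Finset.mem_filter] at hw
        exact (B4Reflection242.mem_blockOf hn1).2 hw.2
      · intro w _ w' _ hww'
        exact Subtype.ext hww'
    have h2 : (B4Reflection242.blockOf n z.1).card = n ^ (d + 1) := by
      unfold B4Reflection242.blockOf
      rw [Fintype.card_piFinset]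
      simp only [Int.card_Ico, add_sub_cancel_left, Int.toNat_natCast, Finset.prod_const, Finset.card_univ, Fintype.card_fin]
    exact_mod_cast (h1.trans h2.le)
  have hL : (1 : ℝ) < (ℓ : ℝ) + 1 := by
    have : (1 : ℝ) ≤ ℓ := by exact_mod_cast hℓ
    linarith
  have hj : 1 ≤ levY x.toKIdx z := (toKT x.toKIdx).D.one_le_lev z.1
  have ha1 : aPrinted ℓ 1 (levY x.toKIdx z) ≤ 1 := B1.aSeq_le (a := (1 : ℝ)) one_pos hL _ hj
  have ha0 : 0 < aPrinted ℓ 1 (levY x.toKIdx z) := B1.aSeq_pos (a := (1 : ℝ)) one_pos hL hj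
  have hnR : (n : ℝ) = ((ℓ : ℝ) + 1) ^ levY x.toKIdx z := by rw [hn]; push_cast; ring
  have hnpos : (0 : ℝ) < (n : ℝ) := by exact_mod_cast hn1
  have hlevC : 0 ≤ levC d ℓ (aPrinted ℓ 1) (levY x.toKIdx z) := by unfold levC; positivity
  rw [← hnR]
  calc ((Finset.univ.filter fun w : SiteY x.toKIdx => blk n w.1 = blk n z.1).card : ℝ) * levC d ℓ (aPrinted ℓ 1) (levY x.toKIdx z)
      ≤ (n : ℝ) ^ (d + 1) * levC d ℓ (aPrinted ℓ 1) (levY x.toKIdx z) := mul_le_mul_of_nonneg_right hcard hlevC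
    _ = aPrinted ℓ 1 (levY x.toKIdx z) * (((n : ℝ)) ^ 2)⁻¹ := by
        unfold levC
        rw [← hnR]
        field_simp
    _ ≤ 1 * (((n : ℝ)) ^ 2)⁻¹ := mul_le_mul_of_nonneg_right ha1 (by positivity)
    _ = (((n : ℝ)) ^ 2)⁻¹ := one_mul _

/-- inside one averaging block: `avgCoeffY(z,w) ≠ 0 ⟹ |h_□(z) − h_□(w)| ≤ avgLipY`. [cite: Balaban1985BackgroundPropagators, (3.88) p.409; Balaban1984PropagatorsII, p.247] -/
theorem abs_sub_le_avgLipY (c : ↥(cubes x.toKIdx.D.toDomains)) {z w : SiteY x.toKIdx} (hw : avgCoeffY x.toKIdx z w ≠ 0) :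
    |hTY x.toKIdx c z - hTY x.toKIdx c w| ≤ avgLipY x :=
  abs_hTY_sub_le_of_avgCoeffY_ne_zero x.toKIdx c hw

/-- ★ under a level-faithful pin the block weight is the pinned length: `L^{−2 lev z} = (η ∕ ℓ(σ z))²`. [cite: Balaban1985BackgroundPropagators, (3.41) p.397 («Lʲη»); Balaban1984PropagatorsII, (2.14) p.225] -/
theorem inv_sq_pow_levY_eq (hlev : ∀ f : FBondY x.toKIdx, lvl x.hN x.D x.hk (bI f) = (B6GlobalChartV1.blkV1 x.hN x.D f).1.1) (z : SiteY x.toKIdx) :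
    ((((ℓ : ℝ) + 1) ^ levY x.toKIdx z) ^ 2)⁻¹ = (etaS x.toKIdx / (geo9Y x).len (sIK x.toKIdx bI z)) ^ 2 := by
  rw [len_sIK_eq_lenB x hlev z, lenB_eq, blkOf_fst_fst]
  have hη := etaS_pos x.toKIdx
  have hL : (0 : ℝ) < ((ℓ : ℝ) + 1) ^ levY x.toKIdx z := by positivity
  field_simp

/-- ★ **THE LEVEL WINDOW OF `S_□`**: a block `a ∈ S_□(c)` of a cube of level `j` is the pin of a site of `□̃(c)`, whose block has level in `[j − 1, j + 1]`
(r03 `window_and_congr_of_mem_QbigT`); under a level-faithful pin `M_h·ℓ(a) ≤ (8∕5·S_j)·η·(5∕8)` and `ℓ(a)`, `ℓ(a′)` of two members of `S_□(c)` compare by `L²`.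
[cite: Balaban1984PropagatorsII, (2.36) p.229, p.235 («□̃»), (2.1)–(2.2) p.224] -/
theorem len_window_of_mem_SblkY (hlev : ∀ f : FBondY x.toKIdx, lvl x.hN x.D x.hk (bI f) = (B6GlobalChartV1.blkV1 x.hN x.D f).1.1)
    (c : ↥(cubes x.toKIdx.D.toDomains)) {a : IBondY x.toKIdx} (ha : a ∈ SblkY x bI c) :
    (x.toKIdx.Mh : ℝ) * (geo9Y x).len a ≤ (bigSide ℓ x.toKIdx.Mh c.1.1 : ℝ) * etaS x.toKIdx ∧
    (((ℓ : ℝ) + 1) ^ c.1.1 * etaS x.toKIdx ≤ ((ℓ : ℝ) + 1) * (geo9Y x).len a) := by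
  obtain ⟨_, hMh, _, _⟩ := side_conditions x.toKIdx
  unfold SblkY at ha
  obtain ⟨w, hw, rfl⟩ := Finset.mem_image.1 ha
  have hwq : blkOf x.D.toDomains w ∈ cubeBlksY x c := by unfold cubeDomY at hw; exact (Finset.mem_filter.1 hw).2
  have hwin := (window_and_congr_of_mem_QbigT (D := x.toKIdx.D) hL hMh x.toKIdx.hR2 (one_le_Mh_and_P x.toKIdx).1 (four_le_P x) hwq).1
  rw [len_sIK_eq_lenB x hlev w, lenB_eq]
  have hη := etaS_pos x.toKIdx
  have hL1 : (1 : ℝ) ≤ (ℓ : ℝ) + 1 := by linarith [(Nat.cast_nonneg ℓ : (0 : ℝ) ≤ ℓ)]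
  constructor
  · rw [bigSide_eq]; push_cast
    have h1 : ((ℓ : ℝ) + 1) ^ (blkOf x.D.toDomains w).1.1 ≤ ((ℓ : ℝ) + 1) ^ (c.1.1 + 1) := pow_le_pow_right₀ hL1 hwin.2
    have hM : (0 : ℝ) ≤ x.toKIdx.Mh := Nat.cast_nonneg _
    calc (x.toKIdx.Mh : ℝ) * (((ℓ : ℝ) + 1) ^ (blkOf x.D.toDomains w).1.1 * etaS x.toKIdx)
        ≤ (x.toKIdx.Mh : ℝ) * (((ℓ : ℝ) + 1) ^ (c.1.1 + 1) * etaS x.toKIdx) := by gcongr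
      _ = ((ℓ : ℝ) + 1) ^ c.1.1 * ((x.toKIdx.Mh : ℝ) * ((ℓ : ℝ) + 1)) * etaS x.toKIdx := by rw [pow_succ]; ring
  · have h1 : ((ℓ : ℝ) + 1) ^ c.1.1 ≤ ((ℓ : ℝ) + 1) ^ ((blkOf x.D.toDomains w).1.1 + 1) := pow_le_pow_right₀ hL1 hwin.1
    calc ((ℓ : ℝ) + 1) ^ c.1.1 * etaS x.toKIdx ≤ ((ℓ : ℝ) + 1) ^ ((blkOf x.D.toDomains w).1.1 + 1) * etaS x.toKIdx := by gcongr
      _ = ((ℓ : ℝ) + 1) * (((ℓ : ℝ) + 1) ^ (blkOf x.D.toDomains w).1.1 * etaS x.toKIdx) := by rw [pow_succ]; ring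

/-- ★ the sizes against the pinned length on `S_□(c)`: `stepY·ℓ(a) ≤ (5∕8)·C1F·η∕M_h` and `lapStepY·ℓ(a)² ≤ (5∕8)²·C2F·η²∕M_h²` — print's `(MLʲη)⁻¹·Lʲη = M⁻¹`.
[cite: Balaban1985BackgroundPropagators, (3.89) p.409 («O(M⁻¹)»); Balaban1984PropagatorsII, (2.44) p.230, p.247] -/
theorem sizes_mul_len_le (hlev : ∀ f : FBondY x.toKIdx, lvl x.hN x.D x.hk (bI f) = (B6GlobalChartV1.blkV1 x.hN x.D f).1.1)
    (c : ↥(cubes x.toKIdx.D.toDomains)) {a : IBondY x.toKIdx} (ha : a ∈ SblkY x bI c) :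
    stepY x c * (geo9Y x).len a ≤ 5 / 8 * C1F d ℓ * etaS x.toKIdx / x.toKIdx.Mh ∧
    lapStepY x c * (geo9Y x).len a ^ 2 ≤ (5 / 8) ^ 2 * C2F d ℓ * etaS x.toKIdx ^ 2 / (x.toKIdx.Mh : ℝ) ^ 2 := by
  obtain ⟨_, hMh, _, _⟩ := side_conditions x.toKIdx
  have hw := (len_window_of_mem_SblkY x bI hlev c ha).1
  have hM : (0 : ℝ) < x.toKIdx.Mh := by exact_mod_cast lt_of_lt_of_le (by norm_num) hMh
  have hS := bigSide_scaled_pos x c.1.1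
  have hlen := (geo9Y_len_pos x a).le
  have hC1 := C1F_nonneg d ℓ
  have hC2 := C2F_nonneg d ℓ
  set S := (bigSide ℓ x.toKIdx.Mh c.1.1 : ℝ) with hSdef
  set len := (geo9Y x).len a
  -- `M_h·len ≤ S·η`
  constructor
  · unfold stepY
    rw [div_mul_eq_mul_div, div_le_div_iff₀ hS hM]
    calc C1F d ℓ * len * (x.toKIdx.Mh : ℝ) = C1F d ℓ * ((x.toKIdx.Mh : ℝ) * len) := by ring
      _ ≤ C1F d ℓ * (S * etaS x.toKIdx) := mul_le_mul_of_nonneg_left hw hC1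
      _ = 5 / 8 * C1F d ℓ * etaS x.toKIdx * (8 / 5 * S) := by ring
  · unfold lapStepY
    have hM2 : (0 : ℝ) < (x.toKIdx.Mh : ℝ) ^ 2 := by positivity
    have hS2 : (0 : ℝ) < (8 / 5 * S) ^ 2 := by positivity
    rw [div_mul_eq_mul_div, div_le_div_iff₀ hS2 hM2]
    have hw2 : ((x.toKIdx.Mh : ℝ) * len) ^ 2 ≤ (S * etaS x.toKIdx) ^ 2 := pow_le_pow_left₀ (by positivity) hw 2
    calc C2F d ℓ * len ^ 2 * (x.toKIdx.Mh : ℝ) ^ 2 = C2F d ℓ * ((x.toKIdx.Mh : ℝ) * len) ^ 2 := by ring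
      _ ≤ C2F d ℓ * (S * etaS x.toKIdx) ^ 2 := mul_le_mul_of_nonneg_left hw2 hC2
      _ = (5 / 8) ^ 2 * C2F d ℓ * etaS x.toKIdx ^ 2 * (8 / 5 * S) ^ 2 := by ring

/-! ### the arithmetic of the sizes: print's `(MLʲη)⁻¹·Lʲη = M⁻¹` -/

/-- the first-order arithmetic: `η⁻¹·P·s·ℓ ≤ P·(5∕8)C1F∕M_h` against `s·ℓ ≤ (5∕8)C1F·η∕M_h`, `P ≥ 0`.
[cite: Balaban1985BackgroundPropagators, (3.89) p.409; Balaban1984PropagatorsII, (2.44) p.230, bookkeeping] -/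
theorem step_arith {P s len : ℝ} (hP : 0 ≤ P) (h : s * len ≤ 5 / 8 * C1F d ℓ * etaS x.toKIdx / x.toKIdx.Mh) :
    (etaS x.toKIdx)⁻¹ * P * s * len ≤ P * (5 / 8 * C1F d ℓ / x.toKIdx.Mh) := by
  have hη := etaS_pos x.toKIdx
  calc (etaS x.toKIdx)⁻¹ * P * s * len = (etaS x.toKIdx)⁻¹ * P * (s * len) := by ring
    _ ≤ (etaS x.toKIdx)⁻¹ * P * (5 / 8 * C1F d ℓ * etaS x.toKIdx / x.toKIdx.Mh) :=
        mul_le_mul_of_nonneg_left h (mul_nonneg (inv_nonneg.2 hη.le) hP)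
    _ = P * (5 / 8 * C1F d ℓ / x.toKIdx.Mh) := by field_simp

/-- the second-order arithmetic: `η⁻²·P·s₂·ℓ² ≤ P·(5∕8)²C2F∕M_h²` against `s₂·ℓ² ≤ (5∕8)²C2F·η²∕M_h²`. [cite: Balaban1985BackgroundPropagators, (3.89) p.409, bookkeeping] -/
theorem lap_arith {P s len : ℝ} (hP : 0 ≤ P) (h : s * len ^ 2 ≤ (5 / 8) ^ 2 * C2F d ℓ * etaS x.toKIdx ^ 2 / (x.toKIdx.Mh : ℝ) ^ 2) :
    (etaS x.toKIdx ^ 2)⁻¹ * P * s * len ^ 2 ≤ P * ((5 / 8) ^ 2 * C2F d ℓ / (x.toKIdx.Mh : ℝ) ^ 2) := by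
  have hη := etaS_pos x.toKIdx
  calc (etaS x.toKIdx ^ 2)⁻¹ * P * s * len ^ 2 = (etaS x.toKIdx ^ 2)⁻¹ * P * (s * len ^ 2) := by ring
    _ ≤ (etaS x.toKIdx ^ 2)⁻¹ * P * ((5 / 8) ^ 2 * C2F d ℓ * etaS x.toKIdx ^ 2 / (x.toKIdx.Mh : ℝ) ^ 2) :=
        mul_le_mul_of_nonneg_left h (mul_nonneg (inv_nonneg.2 (pow_nonneg hη.le 2)) hP)
    _ = P * ((5 / 8) ^ 2 * C2F d ℓ / (x.toKIdx.Mh : ℝ) ^ 2) := by field_simp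

end Stencil

end Literature.MathematicalPhysics.QuantumFieldTheory.Balaban1983to89.B9WalkLettersKernelsStatic

end
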